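import Literature.NumberTheory.GaloisRepresentations.FramedRepTensorKronecker
import HarnessLib

/-!
# The block short exact sequence of an upper-block-triangular framed representation, on the Weil group,
# as sub- and quotient Weil–Deligne representations

Topic `Literature/NumberTheory/GaloisRepresentations`; definitions and theorems only (no named fact, no
instance).  Bookkeeping for the EXACTNESS of `ρ ↦ WD(ρ)` in the tree's framed language — the accepted
`FramedRep.HasUpperBlockForm ρ ρ₁ ρ₂` (`ρ(g) = [[ρ₁(g), *], [0, ρ₂(g)]]` w.r.t. `Fin.castAdd` / `Fin.natAdd`:
a short exact sequence `0 → ρ₁ → ρ → ρ₂ → 0` in an adapted frame, file `DrigArtinianFunctor`, with the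
intertwining lemmas `HasUpperBlockForm.mul_blockInclusion` / `blockProjection_mul`) and the accepted
`WeilDeligneRep.IsSubrep` / `ofSubrep` / `toQuotient` (file `LocalConstants`) — needed by the candidate clause
(F16) `PstWeilDeligneData.SubquotientCompatible` (file `PstWeilDeligneSubquotientCompatible`).

* §1 `blockKer_eq_blockRange`, `blockInclusion_toLin'_injective`, `blockProjection_toLin'_surjective` — the
  accepted matrices `FramedRep.blockInclusion` / `FramedRep.blockProjection` give the short exact sequence
  `0 → A^{n₁} → A^{n₁+n₂} → A^{n₂} → 0` (Bourbaki, *Algebra* II §1 no. 4).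
* §2 `FramedRep.HasUpperBlockForm.weilRestrict_comp_blockInclusion` / `.blockProjection_comp_weilRestrict`
  (the two intertwinings on `W_F`), `.blockKer_isSubrep`, `.subrepresentationEquiv`, `.quotientEquiv`,
  `.exists_isSubrep_ofRep_weilRestrict` — for an upper-block framed `ρ` of `Γ_F` with blocks `ρ₁`, `ρ₂`,
  the kernel of the block projection is a sub-Weil–Deligne representation of `(ρ|_{W_F}, 0)` isomorphic to
  `(ρ₁|_{W_F}, 0)`, with quotient isomorphic to `(ρ₂|_{W_F}, 0)` (Deligne 1973 §8.4.1: the category of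
  Weil–Deligne representations is abelian; Tate 1979 (4.1.5)).

## References
* N. Bourbaki, *Algebra I*, II §1 no. 4 (exact sequences), II §10 (block matrices). [BourbakiAlgebraI1989]
* P. Deligne, *Les constantes des équations fonctionnelles des fonctions L*, Antwerp II, LNM 349 (1973),
  §8.4.1. [DeligneAntwerpII1973]
* J. Tate, *Number theoretic background*, Corvallis 1979, (4.1.2)–(4.1.6). [TateCorvallis1979]
-/

noncomputable section

open scoped MatrixGroups Matrix
open Field

namespace Literature.NumberTheory.GaloisRepresentations

/-! ### §1 The block short exact sequence `0 → A^{n₁} → A^{n₁+n₂} → A^{n₂} → 0` -/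

section Blocks

variable {A : Type*} [CommRing A] {n₁ n₂ : ℕ}

/-- `blockProjection *ᵥ v` reads off the second block of coordinates (private computation). [folklore] -/
private theorem blockProjection_mulVec (v : Fin (n₁ + n₂) → A) (i : Fin n₂) :
    (FramedRep.blockProjection A n₁ n₂ *ᵥ v) i = v (Fin.natAdd n₁ i) := by
  simp [FramedRep.blockProjection, Matrix.mulVec, dotProduct, Matrix.one_apply]

/-- The two index blocks are disjoint (private). [folklore] -/
private theorem natAdd_ne_castAdd (i : Fin n₂) (j : Fin n₁) : Fin.natAdd n₁ i ≠ Fin.castAdd n₂ j := by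
  intro h
  have h' := congrArg Fin.val h
  simp only [Fin.val_natAdd, Fin.val_castAdd] at h'
  omega

/-- `blockInclusion *ᵥ x` has first block `x` (private computation). [folklore] -/
private theorem blockInclusion_mulVec_castAdd (x : Fin n₁ → A) (j : Fin n₁) :
    (FramedRep.blockInclusion A n₁ n₂ *ᵥ x) (Fin.castAdd n₂ j) = x j := by
  simp [FramedRep.blockInclusion, Matrix.mulVec, dotProduct, Matrix.one_apply]

/-- `blockInclusion *ᵥ x` has second block `0` (private computation). [folklore] -/
private theorem blockInclusion_mulVec_natAdd (x : Fin n₁ → A) (i : Fin n₂) :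
    (FramedRep.blockInclusion A n₁ n₂ *ᵥ x) (Fin.natAdd n₁ i) = 0 := by
  simp [FramedRep.blockInclusion, Matrix.mulVec, dotProduct, natAdd_ne_castAdd]

/-- **Exactness in the middle**: the kernel of the block projection `A^{n₁+n₂} → A^{n₂}` is the range of the
block inclusion `A^{n₁} → A^{n₁+n₂}`. [cite: BourbakiAlgebraI1989, II §1 no. 4] -/
theorem blockKer_eq_blockRange :
    LinearMap.ker (Matrix.toLin' (FramedRep.blockProjection A n₁ n₂)) =
      LinearMap.range (Matrix.toLin' (FramedRep.blockInclusion A n₁ n₂)) := by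
  refine le_antisymm (fun v hv => ?_) ?_
  · rw [LinearMap.mem_ker, Matrix.toLin'_apply] at hv
    refine ⟨fun j => v (Fin.castAdd n₂ j), ?_⟩
    rw [Matrix.toLin'_apply]
    refine funext fun k => Fin.addCases (fun j => ?_) (fun i => ?_) k
    · rw [blockInclusion_mulVec_castAdd]
    · rw [blockInclusion_mulVec_natAdd, ← blockProjection_mulVec v i, hv, Pi.zero_apply]
  · rintro _ ⟨x, rfl⟩
    rw [LinearMap.mem_ker, Matrix.toLin'_apply, Matrix.toLin'_apply]
    exact funext fun i => by rw [blockProjection_mulVec, blockInclusion_mulVec_natAdd, Pi.zero_apply]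

/-- The block inclusion `A^{n₁} → A^{n₁+n₂}` is injective. [cite: BourbakiAlgebraI1989, II §1 no. 4] -/
theorem blockInclusion_toLin'_injective :
    Function.Injective (Matrix.toLin' (FramedRep.blockInclusion A n₁ n₂)) := fun x y h => by
  refine funext fun j => ?_
  have h' := congrFun h (Fin.castAdd n₂ j)
  rwa [Matrix.toLin'_apply, Matrix.toLin'_apply, blockInclusion_mulVec_castAdd,
    blockInclusion_mulVec_castAdd] at h'

/-- The block projection `A^{n₁+n₂} → A^{n₂}` is surjective. [cite: BourbakiAlgebraI1989, II §1 no. 4] -/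
theorem blockProjection_toLin'_surjective :
    Function.Surjective (Matrix.toLin' (FramedRep.blockProjection A n₁ n₂)) := fun y =>
  ⟨Fin.addCases (fun _ => (0 : A)) y, funext fun i => by
    rw [Matrix.toLin'_apply, blockProjection_mulVec, Fin.addCases_right]⟩

end Blocks

end Literature.NumberTheory.GaloisRepresentations

namespace Literature.NumberTheory.GaloisRepresentations

/-! ### §2 The block subrepresentation of an upper-block framed representation, on the Weil group -/

section BlockSubrep

variable {F : Type} [Field F] [ValuativeRel F] [TopologicalSpace F] [IsNonarchimedeanLocalField F]
  {A : Type*} [Field A] [CharZero A] [TopologicalSpace A] {n₁ n₂ : ℕ}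
  {ρ : FramedRep (absoluteGaloisGroup F) A (n₁ + n₂)} {ρ₁ : FramedRep (absoluteGaloisGroup F) A n₁}
  {ρ₂ : FramedRep (absoluteGaloisGroup F) A n₂}

omit [CharZero A] in
/-- The restriction to `W_F` of a framed representation, at `w`, is `toLin'` of the matrix `ρ(w)`
(private unfolding helper). [folklore] -/
private theorem weilRestrict_eq_toLin' {n : ℕ} (τ : FramedRep (absoluteGaloisGroup F) A n) (w : WeilGroup F) :
    τ.weilRestrict F w = Matrix.toLin' ((τ (WeilGroup.toAbsGalois F w) : GL (Fin n) A) : Matrix (Fin n) (Fin n) A) :=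
  LinearMap.ext fun v => by rw [FramedRep.weilRestrict_apply_apply, Matrix.toLin'_apply]

omit [CharZero A] in
/-- For an upper-block `ρ`, the block inclusion intertwines `ρ₁|_{W_F}` into `ρ|_{W_F}`:
`ρ(w) ∘ ι = ι ∘ ρ₁(w)` (accepted `HasUpperBlockForm.mul_blockInclusion`). [cite: BourbakiAlgebraI1989, II §1 no. 4] -/
theorem FramedRep.HasUpperBlockForm.weilRestrict_comp_blockInclusion (h : ρ.HasUpperBlockForm ρ₁ ρ₂)
    (w : WeilGroup F) :
    ρ.weilRestrict F w ∘ₗ Matrix.toLin' (FramedRep.blockInclusion A n₁ n₂) =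
      Matrix.toLin' (FramedRep.blockInclusion A n₁ n₂) ∘ₗ ρ₁.weilRestrict F w := by
  rw [weilRestrict_eq_toLin', weilRestrict_eq_toLin', ← Matrix.toLin'_mul, ← Matrix.toLin'_mul,
    (h (WeilGroup.toAbsGalois F w)).mul_blockInclusion]

omit [CharZero A] in
/-- For an upper-block `ρ`, the block projection intertwines `ρ|_{W_F}` onto `ρ₂|_{W_F}`:
`π ∘ ρ(w) = ρ₂(w) ∘ π` (accepted `HasUpperBlockForm.blockProjection_mul`). [cite: BourbakiAlgebraI1989, II §1 no. 4] -/
theorem FramedRep.HasUpperBlockForm.blockProjection_comp_weilRestrict (h : ρ.HasUpperBlockForm ρ₁ ρ₂)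
    (w : WeilGroup F) :
    Matrix.toLin' (FramedRep.blockProjection A n₁ n₂) ∘ₗ ρ.weilRestrict F w =
      ρ₂.weilRestrict F w ∘ₗ Matrix.toLin' (FramedRep.blockProjection A n₁ n₂) := by
  rw [weilRestrict_eq_toLin', weilRestrict_eq_toLin', ← Matrix.toLin'_mul, ← Matrix.toLin'_mul,
    (h (WeilGroup.toAbsGalois F w)).blockProjection_mul]

/-- **The block kernel is a sub-Weil–Deligne representation** of `(ρ|_{W_F}, 0)` for an upper-block `ρ`.
[cite: DeligneAntwerpII1973, §8.4.1] -/
theorem FramedRep.HasUpperBlockForm.blockKer_isSubrep (h : ρ.HasUpperBlockForm ρ₁ ρ₂)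
    (hc : WeilGroup.IsContinuousRep (ρ.weilRestrict F)) :
    (WeilDeligneRep.ofRep (ρ.weilRestrict F) hc).IsSubrep
      (LinearMap.ker (Matrix.toLin' (FramedRep.blockProjection A n₁ n₂))) := by
  refine ⟨fun w v hv => ?_, fun v _ => ?_⟩
  · rw [Submodule.mem_comap, LinearMap.mem_ker, WeilDeligneRep.ofRep_ρ, ← LinearMap.comp_apply,
      h.blockProjection_comp_weilRestrict, LinearMap.comp_apply, LinearMap.mem_ker.1 hv, map_zero]
  · rw [Submodule.mem_comap, WeilDeligneRep.ofRep_N, LinearMap.zero_apply]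
    exact Submodule.zero_mem _

/-- **The sub-object is `(ρ₁|_{W_F}, 0)`**: the block inclusion is an isomorphism of representations from
`ρ₁|_{W_F}` onto the block kernel of `ρ|_{W_F}`. [cite: DeligneAntwerpII1973, §8.4.1] -/
def FramedRep.HasUpperBlockForm.subrepresentationEquiv (h : ρ.HasUpperBlockForm ρ₁ ρ₂)
    (hc : WeilGroup.IsContinuousRep (ρ.weilRestrict F)) :
    Representation.Equiv (ρ₁.weilRestrict F)
      ((WeilDeligneRep.ofRep (ρ.weilRestrict F) hc).ofSubrep _ (h.blockKer_isSubrep hc)).ρ :=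
  Representation.Equiv.mk
    ((LinearEquiv.ofInjective _ blockInclusion_toLin'_injective).trans
      (LinearEquiv.ofEq _ _ blockKer_eq_blockRange.symm))
    fun w => LinearMap.ext fun x => Subtype.ext (by
      change Matrix.toLin' (FramedRep.blockInclusion A n₁ n₂) (ρ₁.weilRestrict F w x) =
        ρ.weilRestrict F w (Matrix.toLin' (FramedRep.blockInclusion A n₁ n₂) x)
      rw [← LinearMap.comp_apply, ← h.weilRestrict_comp_blockInclusion w, LinearMap.comp_apply])

/-- **The quotient is `(ρ₂|_{W_F}, 0)`**: the block projection induces an isomorphism of representations from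
the quotient of `ρ|_{W_F}` by the block kernel onto `ρ₂|_{W_F}`. [cite: DeligneAntwerpII1973, §8.4.1] -/
def FramedRep.HasUpperBlockForm.quotientEquiv (h : ρ.HasUpperBlockForm ρ₁ ρ₂)
    (hc : WeilGroup.IsContinuousRep (ρ.weilRestrict F)) :
    Representation.Equiv ((WeilDeligneRep.ofRep (ρ.weilRestrict F) hc).toQuotient _ (h.blockKer_isSubrep hc)).ρ
      (ρ₂.weilRestrict F) :=
  Representation.Equiv.mk
    (LinearMap.quotKerEquivOfSurjective _ blockProjection_toLin'_surjective)
    fun w => Submodule.linearMap_qext _ (LinearMap.ext fun v => by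
      change LinearMap.quotKerEquivOfSurjective _ blockProjection_toLin'_surjective
          (Submodule.Quotient.mk (ρ.weilRestrict F w v)) =
        ρ₂.weilRestrict F w (LinearMap.quotKerEquivOfSurjective _ blockProjection_toLin'_surjective
          (Submodule.Quotient.mk v))
      rw [LinearMap.quotKerEquivOfSurjective_apply_mk, LinearMap.quotKerEquivOfSurjective_apply_mk,
        ← LinearMap.comp_apply, h.blockProjection_comp_weilRestrict w, LinearMap.comp_apply])

/-- **Exactness of `ρ ↦ (ρ|_{W_F}, 0)` on an upper-block framed representation**: `(ρ|_{W_F}, 0)` has a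
sub-Weil–Deligne representation isomorphic to `(ρ₁|_{W_F}, 0)` with quotient isomorphic to `(ρ₂|_{W_F}, 0)`.
[cite: DeligneAntwerpII1973, §8.4.1] [cite: TateCorvallis1979, (4.1.5)] -/
theorem FramedRep.HasUpperBlockForm.exists_isSubrep_ofRep_weilRestrict (h : ρ.HasUpperBlockForm ρ₁ ρ₂)
    (hc : WeilGroup.IsContinuousRep (ρ.weilRestrict F)) (hc₁ : WeilGroup.IsContinuousRep (ρ₁.weilRestrict F))
    (hc₂ : WeilGroup.IsContinuousRep (ρ₂.weilRestrict F)) :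
    ∃ (p : Submodule A (Fin (n₁ + n₂) → A)) (hp : (WeilDeligneRep.ofRep (ρ.weilRestrict F) hc).IsSubrep p),
      ((WeilDeligneRep.ofRep (ρ.weilRestrict F) hc).ofSubrep p hp).IsEquivalent
          (WeilDeligneRep.ofRep (ρ₁.weilRestrict F) hc₁) ∧
        ((WeilDeligneRep.ofRep (ρ.weilRestrict F) hc).toQuotient p hp).IsEquivalent
          (WeilDeligneRep.ofRep (ρ₂.weilRestrict F) hc₂) := by
  refine ⟨_, h.blockKer_isSubrep hc, ⟨WeilDeligneRep.Equiv.ofRepEquivOfN (h.subrepresentationEquiv hc).symm ?_ rfl⟩,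
    ⟨WeilDeligneRep.Equiv.ofRepEquivOfN (h.quotientEquiv hc) ?_ rfl⟩⟩
  · exact LinearMap.ext fun x => Subtype.ext rfl
  · exact Submodule.linearMap_qext _ (LinearMap.ext fun v => rfl)

end BlockSubrep

end Literature.NumberTheory.GaloisRepresentations

end
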